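import Summits.ABC.ABC.Theorems.IsogenyGlueCongruencePolyDegreeOfBoundedPrimesOptimalCalibration
import Summits.ABC.ABC.Theorems.IsogenyGlueCongruencePolyDegreeOfBoundedPrimesManinBoundOfFacts

/-!
# Crux B (`PolyDegreeOfBoundedPrimes`, stmt-ABC-2046, line `Sketch`): the optimal-curve calibration in ITEM form

The cycle-4 calibration of crux B (`IsogenyGlueCongruencePolyDegreeOfBoundedPrimesOptimalCalibration`, p114386,
and the rider `maninBound_of_facts`, p114821) stated its Mazur–Kenku and modularity inputs as Literature named
facts. Both inputs are ITEMS of route IsogenyGlueCongruence, whose bodies repeat those facts verbatim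
(definitional equality): `MazurKenkuBound` (stmt-ABC-15125) and `ModularDatumExists` (stmt-ABC-15126). This file
is the item-form re-wiring requested by the route-choice planner (rchoice 194e94e5, 2026-08-16): every theorem
below takes `(hMK : MazurKenkuBound)` / `(hMod : ModularDatumExists)` and is a one-line specialisation of the
landed `…_of_facts` theorem, so that no file of this line names an apex Literature fact as a hypothesis.

The two remaining named-fact hypotheses are NOT route items and stay as they are:

* `hEd`  — `Literature.NumberTheory.EllipticCurves.edixhoven_int_of_neronLattice_eq_smul_periodLattice`
  (Edixhoven 1991, Prop. 2 = Agashe–Ribet–Stein 2006, Thm. 2.2, lattice form);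
* `hCes` — the universal closure of `ModularParametrizationData.abs_maninConstant_eq_one_of_isSemistable`
  (Česnavičius 2018, Thm. 1.2);
* and, for the Manin rider only, `hNS` — `Literature.NumberTheory.EllipticCurves.integral_neronScaling_of_isGloballyMinimal`
  (Silverman ATAEC IV.5.1 with IV.6.1 and Cor. IV.9.1).

Content (all modulo `hEd`, `hCes` and the route item `MazurKenkuBound`; `H` = the polynomial height conjecture for
semistable curves, `∃ σ C, ∀ W semistable globally minimal, max(|Δ_W|, |c₄(W)|³) ≤ C·N_W^σ`; `P` = the consequent
of crux B; `A` = `DegreePrimesPolyBounded`):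

* `polyDegreeGivenData_of_polyHeight_of_items` : `H →` every semistable globally minimal `W` with a datum has a
  datum of degree `≤ C·N^κ`;
* `polyDegreeOfBoundedPrimes_of_polyHeight_of_items` : `H → B` (the line; A supplies the datum);
* `polyDegree_iff_polyHeight_of_items` : with `ModularDatumExists`, `P ↔ H`;
* `manin_of_polyHeight_of_items` : with `ModularDatumExists`, `H →` polynomially bounded Manin data;
* `maninBound_of_items` : with `hNS`, every globally minimal `W` with a datum at square-free level has a datum with
  the same newform and `|c| ≤ 163`.

(`B ↔ (A → H)` in item form is already in the tree: `polyDegreeOfBoundedPrimes_iff_polyHeight_of_mazurKenku`.)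
No definition, no new named fact; supports stmt-ABC-2046.

References: M. R. Murty, *Bounds for congruence primes* (1999), Thm 1 (ii), §2; H. Pasten, *Shimura curves and
the abc conjecture*, J. Number Theory 254 (2024), §3 p. 13; B. Edixhoven, *On the Manin constants of modular elliptic
curves* (1991), Prop. 2; K. Česnavičius, *The Manin constant in the semistable case*, Compositio Math. 154 (2018),
Thm. 1.2; B. Mazur, *Rational isogenies of prime degree* (1978), Thm. 1; M. A. Kenku (1982).
-/

noncomputable section

-- single-conjunct summit ABC: the duplicate ABC.ABC is mandated (CONVENTIONS §2)
set_option linter.dupNamespace false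

namespace Summit.ABC.ABC.Theorems

open Literature.NumberTheory.EllipticCurves Literature.NumberTheory.EllipticCurves.ModularForms
open CongruenceSubgroup
open Summit.ABC.ABC.Theses.IsogenyGlueCongruence

/-- **`P` given data, from `H`**, item form: granted Edixhoven (lattice form), Česnavičius and the route item
`MazurKenkuBound`, the polynomial height hypothesis `H` yields `κ, C` such that every semistable globally minimal
elliptic `W/ℚ` carrying SOME datum at level `N_W` has a datum of degree `≤ C · N_W^κ` (Murty 1999 Thm 1 (ii) on the
optimal curve, transferred by Mazur–Kenku). [cite: MurtyCongruencePrimes1999, Thm. 1 (ii) and §2]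
[cite: PastenShimura2024, §3 p. 13] -/
theorem polyDegreeGivenData_of_polyHeight_of_items
    (hEd : edixhoven_int_of_neronLattice_eq_smul_periodLattice)
    (hCes : ∀ {W' : WeierstrassCurve ℚ} {N' : ℕ} [NeZero N']
      (D' : ModularParametrizationData W' N'), D'.abs_maninConstant_eq_one_of_isSemistable)
    (hMK : MazurKenkuBound)
    (hH : ∃ σ C : ℝ, ∀ (W : WeierstrassCurve ℚ) [W.IsElliptic] [W.IsGloballyMinimal]
      [NeZero (W.conductorNorm ℤ)], W.IsSemistable ℤ →
      ((max |W.Δ| (|W.c₄| ^ 3) : ℚ) : ℝ) ≤ C * (W.conductorNorm ℤ : ℝ) ^ σ) :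
    ∃ κ C : ℝ, ∀ (W : WeierstrassCurve ℚ) [W.IsElliptic] [W.IsGloballyMinimal]
      [NeZero (W.conductorNorm ℤ)], W.IsSemistable ℤ →
      Nonempty (ModularParametrizationData W (W.conductorNorm ℤ)) →
      ∃ D : ModularParametrizationData W (W.conductorNorm ℤ),
        (D.modularDegree : ℝ) ≤ C * (W.conductorNorm ℤ : ℝ) ^ κ :=
  polyDegreeGivenData_of_polyHeight_of_facts hEd hCes hMK hH

/-- **`H → B`**, item form (the line `Sketch`: hypothesis A of the crux supplies the datum of `W`, its only use):
Edixhoven → Česnavičius → `MazurKenkuBound` → H → B. Registered sub-goal of stmt-ABC-2046 (name + one-line signature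
verbatim). [cite: MurtyCongruencePrimes1999, Thm. 1 (ii) and §2] -/
theorem polyDegreeOfBoundedPrimes_of_polyHeight_of_items : Literature.NumberTheory.EllipticCurves.edixhoven_int_of_neronLattice_eq_smul_periodLattice → (∀ {W' : WeierstrassCurve ℚ} {N' : ℕ} [NeZero N'] (D' : Literature.NumberTheory.EllipticCurves.ModularForms.ModularParametrizationData W' N'), D'.abs_maninConstant_eq_one_of_isSemistable) → Summit.ABC.ABC.Theses.IsogenyGlueCongruence.MazurKenkuBound → (∃ σ C : ℝ, ∀ (W : WeierstrassCurve ℚ) [W.IsElliptic] [W.IsGloballyMinimal] [NeZero (W.conductorNorm ℤ)], W.IsSemistable ℤ → ((max |W.Δ| (|W.c₄| ^ 3) : ℚ) : ℝ) ≤ C * (W.conductorNorm ℤ : ℝ) ^ σ) → Summit.ABC.ABC.Theses.IsogenyGlueCongruence.PolyDegreeOfBoundedPrimes :=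
  fun hEd hCes hMK hH ↦ polyDegreeOfBoundedPrimes_of_polyHeight_of_facts hEd hCes hMK hH

/-- **`P ↔ H`**, item form: modulo Edixhoven, Česnavičius and the route items `MazurKenkuBound`,
`ModularDatumExists`, the consequent of crux B is the polynomial height conjecture for semistable curves; `→` is
unconditional (`polyHeight_of_polyDegree`). [cite: MurtyCongruencePrimes1999, Thm. 1 and §2] -/
theorem polyDegree_iff_polyHeight_of_items
    (hEd : edixhoven_int_of_neronLattice_eq_smul_periodLattice)
    (hCes : ∀ {W' : WeierstrassCurve ℚ} {N' : ℕ} [NeZero N']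
      (D' : ModularParametrizationData W' N'), D'.abs_maninConstant_eq_one_of_isSemistable)
    (hMK : MazurKenkuBound) (hMod : ModularDatumExists) :
    (∃ κ C : ℝ, ∀ (W : WeierstrassCurve ℚ) [W.IsElliptic] [W.IsGloballyMinimal]
      [NeZero (W.conductorNorm ℤ)], W.IsSemistable ℤ →
      ∃ D : ModularParametrizationData W (W.conductorNorm ℤ),
        (D.modularDegree : ℝ) ≤ C * (W.conductorNorm ℤ : ℝ) ^ κ) ↔
    (∃ σ C : ℝ, ∀ (W : WeierstrassCurve ℚ) [W.IsElliptic] [W.IsGloballyMinimal]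
      [NeZero (W.conductorNorm ℤ)], W.IsSemistable ℤ →
      ((max |W.Δ| (|W.c₄| ^ 3) : ℚ) : ℝ) ≤ C * (W.conductorNorm ℤ : ℝ) ^ σ) :=
  polyDegree_iff_polyHeight_of_facts hEd hCes hMK hMod

/-- **Polynomially bounded Manin data from `H`**, item form: modulo Edixhoven, Česnavičius, `MazurKenkuBound` and
`ModularDatumExists`, the height hypothesis `H` gives back the Manin half `M` of the cycle-3 calibration
`B ↔ (A → H ∧ M)` (through `P`, by `manin_of_polyDegree`). [cite: MurtyCongruencePrimes1999, §2] -/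
theorem manin_of_polyHeight_of_items
    (hEd : edixhoven_int_of_neronLattice_eq_smul_periodLattice)
    (hCes : ∀ {W' : WeierstrassCurve ℚ} {N' : ℕ} [NeZero N']
      (D' : ModularParametrizationData W' N'), D'.abs_maninConstant_eq_one_of_isSemistable)
    (hMK : MazurKenkuBound) (hMod : ModularDatumExists)
    (hH : ∃ σ C : ℝ, ∀ (W : WeierstrassCurve ℚ) [W.IsElliptic] [W.IsGloballyMinimal]
      [NeZero (W.conductorNorm ℤ)], W.IsSemistable ℤ →
      ((max |W.Δ| (|W.c₄| ^ 3) : ℚ) : ℝ) ≤ C * (W.conductorNorm ℤ : ℝ) ^ σ) :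
    ∃ a M₀ : ℝ, ∀ (W : WeierstrassCurve ℚ) [W.IsElliptic] [W.IsGloballyMinimal]
      [NeZero (W.conductorNorm ℤ)], W.IsSemistable ℤ →
      ∃ D : ModularParametrizationData W (W.conductorNorm ℤ),
        |(D.maninConstant : ℝ)| ≤ M₀ * (W.conductorNorm ℤ : ℝ) ^ a :=
  manin_of_polyHeight_of_facts hEd hCes hMK hMod hH

/-- **The Manin input is fact-grade, item form**: modulo Edixhoven, Česnavičius, the route item `MazurKenkuBound`
and the integrality of Néron scalings, every globally minimal elliptic `W/ℚ` with a datum `D` at a square-free level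
`N` has a datum `D'` with the same newform and `|c_{D'}| ≤ 163` (`maninBound_of_facts`).
[cite: EdixhovenManin1991, Prop. 2] [cite: Cesnavicius2018, Thm. 1.2] [cite: PastenShimura2024, §3 p. 13]
[cite: SilvermanATAEC1994, IV.5.1] -/
theorem maninBound_of_items
    (hEd : edixhoven_int_of_neronLattice_eq_smul_periodLattice)
    (hCes : ∀ {W' : WeierstrassCurve ℚ} {N' : ℕ} [NeZero N']
      (D' : ModularParametrizationData W' N'), D'.abs_maninConstant_eq_one_of_isSemistable)
    (hMK : MazurKenkuBound) (hNS : integral_neronScaling_of_isGloballyMinimal)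
    (N : ℕ) [NeZero N] (W : WeierstrassCurve ℚ) [W.IsElliptic] [W.IsGloballyMinimal]
    (D : ModularParametrizationData W N) (hN : Squarefree N) :
    ∃ D' : ModularParametrizationData W N, D'.f = D.f ∧ |D'.maninConstant| ≤ 163 :=
  maninBound_of_facts hEd hCes hMK hNS N W D hN

/-- **The calibration's Manin input `M` with exponent `0`, item form** (rchoice 74d47492 request): modulo Edixhoven,
Česnavičius, Néron scaling and the route items `MazurKenkuBound`, `ModularDatumExists`, every semistable globally minimal
elliptic `W/ℚ` has a datum at level `N_W` with `|c| ≤ 163 · N_W^0`. [cite: Cesnavicius2018, Thm. 1.2]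
[cite: PastenShimura2024, §3 p. 13] -/
theorem maninData_of_items
    (hEd : edixhoven_int_of_neronLattice_eq_smul_periodLattice)
    (hCes : ∀ {W' : WeierstrassCurve ℚ} {N' : ℕ} [NeZero N']
      (D' : ModularParametrizationData W' N'), D'.abs_maninConstant_eq_one_of_isSemistable)
    (hMK : MazurKenkuBound) (hNS : integral_neronScaling_of_isGloballyMinimal) (hMod : ModularDatumExists) :
    ∃ a M₀ : ℝ, ∀ (W : WeierstrassCurve ℚ) [W.IsElliptic] [W.IsGloballyMinimal]
      [NeZero (W.conductorNorm ℤ)], W.IsSemistable ℤ →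
      ∃ D : ModularParametrizationData W (W.conductorNorm ℤ),
        |(D.maninConstant : ℝ)| ≤ M₀ * (W.conductorNorm ℤ : ℝ) ^ a := by
  refine ⟨0, 163, fun W _ _ _ hss ↦ ?_⟩
  obtain ⟨D⟩ := hMod W
  have hsq : Squarefree (W.conductorNorm ℤ) := (W.isSemistable_iff_squarefree_conductorNorm).mp hss
  obtain ⟨D', -, hc⟩ := maninBound_of_items hEd hCes hMK hNS (W.conductorNorm ℤ) W D hsq
  refine ⟨D', ?_⟩
  rw [Real.rpow_zero, mul_one, ← Int.cast_abs]
  exact_mod_cast hc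

/-- **The same with the datum supplied by crux A** (`DegreePrimesPolyBounded`) instead of `ModularDatumExists` — the form
used inside crux B, whose hypothesis A provides a datum of every semistable globally minimal curve.
[cite: Cesnavicius2018, Thm. 1.2] [cite: PastenShimura2024, §3 p. 13] -/
theorem maninData_of_items_of_degreePrimes
    (hEd : edixhoven_int_of_neronLattice_eq_smul_periodLattice)
    (hCes : ∀ {W' : WeierstrassCurve ℚ} {N' : ℕ} [NeZero N']
      (D' : ModularParametrizationData W' N'), D'.abs_maninConstant_eq_one_of_isSemistable)
    (hMK : MazurKenkuBound) (hNS : integral_neronScaling_of_isGloballyMinimal) (hA : DegreePrimesPolyBounded) :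
    ∃ a M₀ : ℝ, ∀ (W : WeierstrassCurve ℚ) [W.IsElliptic] [W.IsGloballyMinimal]
      [NeZero (W.conductorNorm ℤ)], W.IsSemistable ℤ →
      ∃ D : ModularParametrizationData W (W.conductorNorm ℤ),
        |(D.maninConstant : ℝ)| ≤ M₀ * (W.conductorNorm ℤ : ℝ) ^ a := by
  obtain ⟨κ, C, hA⟩ := hA
  refine ⟨0, 163, fun W _ _ _ hss ↦ ?_⟩
  obtain ⟨D, -⟩ := hA W hss
  have hsq : Squarefree (W.conductorNorm ℤ) := (W.isSemistable_iff_squarefree_conductorNorm).mp hss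
  obtain ⟨D', -, hc⟩ := maninBound_of_items hEd hCes hMK hNS (W.conductorNorm ℤ) W D hsq
  refine ⟨D', ?_⟩
  rw [Real.rpow_zero, mul_one, ← Int.cast_abs]
  exact_mod_cast hc

end Summit.ABC.ABC.Theorems

end
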